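import Literature.Probability.Percolation.PairAttachmentSepRate
import HarnessLib

/-! # Crux `PercNearOneGluing.AdditiveGluing` (stmt-CriticalPhenomena-4576) — Kozma–Nitzan's Theorem 1 for a SET (contracted) observer
# with the witness designated in the uncontracted graph (seat (b) V⁺-form `png-dp-vplus`, gen 10)

Support file (`--supports stmt-CriticalPhenomena-4576`); no definitions, no named facts, no sorries.

Conjecture G (`stub_fingerML3_vp`) is the statement "KN (3) at the CONTRACTED block `N` of `K/N`, with the witness `d` designated by
the two-point function of the UNcontracted `K`" (memo MEMO-gen10.md §3, §8 of run/shared/lean/prim/prim-png-dp-vplus/: SET-W / SET-4,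
0 violations in 2.2·10⁸ exact instances, ttrl setw/SETW.md; the hypothesis-free gluing and all 4-point shortcuts are refuted there).
THIS FILE proves its base case, two relays `{c, a}`: Kozma–Nitzan's THEOREM 1 (`|A| = 2`, arXiv:2401.12397 pp. 7–8, tree
`KNPreFKG.preFKG_pair`) with the observer replaced by an arbitrary vertex SET `O` (read: `O` contracted to one vertex) while the
comparison `μ(c ↔ b) ≤ μ(a ↔ b)` is read in the ORIGINAL graph.  Writing `O ~ v := ⋃_{o∈O} {v ↔ o}` and `O ≁ v := ⋂_{o∈O} {v ↮ o}`:

* `setObserver_pair_exchange` (hypothesis-free, quantitative, = the printed "BHK four times" with set events):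
  `μ(a ↮ c)·[μ(a↔b, O~a, O≁c) − μ(c↔b, O~a, O≁c)] ≥ μ(O~a, O≁c)·[μ(a↔b) − μ(c↔b)]`.
  Proof: given `D = {a ↮ c}`, `{a↔b}` and `{O~a} ∩ {O≁c}` are increasing in `C_a` / decreasing in `C_c` (positively correlated,
  BHK 2006 Thm 1.5 = tree `setTwoClusterExchange` / `typePlus_posAssoc`), `{c↔b}` is increasing in `C_c` (negatively correlated with
  `{O~a}∩{O≁c}`), and `μ(a↔b, D) − μ(c↔b, D) = μ(a↔b) − μ(c↔b)` (on `{a ↔ c}` the two events coincide).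
* `setObserver_pair` — if `μ(c↔b) ≤ μ(a↔b)` then `μ(c↔b, O~a, O≁c) ≤ μ(a↔b, O~a, O≁c) ≤ μ(O~b, O~a, O≁c)`: in the contracted graph
  `Γ/O` this is exactly KN (3) at the contracted vertex with relay set `{c, a}` and witness `c` chosen in `Γ` (for `O = {o}` it is
  Theorem 1); in particular the V⁺ statement SET-W for one competitor relay: `μ(c↔b, O~a, O≁c) ≤ μ(O~b, O≁c)` (`setObserver_pair_setW`).
[cite: KozmaNitzan2024, Thm 1 (pp. 7–8), display (3) (p. 3)] [cite: VandenbergHaggstromKahn2005, Thms 1.3, 1.5 (p. 6), Thm 2.1 (p. 9)]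
-/

namespace Summit.CriticalPhenomena.PercolationContinuityZ3.Theorems

open MeasureTheory Set
open Literature.Probability.LatticeModels (prodBernoulli)
open Literature.Probability.Percolation
open Literature.Probability.Percolation.TwoSetExchange Literature.Probability.Percolation.PairAttachmentSepRate

noncomputable section
open Classical

section SetObserverPair

variable {V : Type*} [Fintype V]

omit [Fintype V] in
/-- The separation event of `setTwoClusterExchange` for the singletons `S = {a}`, `T = {c}` is `{a ↮ c}`. [folklore] -/
theorem sep_singleton_singleton_eq (a c : V) :
    {ω : BondConfig V | ∀ s ∈ ({a} : Set V), ∀ t ∈ ({c} : Set V), ¬ (openGraph ω).Reachable s t} =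
      ((openConn a c)ᶜ : Set (BondConfig V)) := by
  ext ω
  simp only [mem_setOf_eq, mem_singleton_iff, forall_eq, mem_compl_iff]
  rfl

/-- **KN Theorem 1 with a set observer, quantitative exchange form ("BHK four times").**  For vertices `a, c, b` and any vertex set `O`:
`μ(a ↮ c)·(μ(a↔b ∩ O~a ∩ O≁c) − μ(c↔b ∩ O~a ∩ O≁c)) ≥ μ(O~a ∩ O≁c)·(μ(a↔b) − μ(c↔b))`.
[cite: KozmaNitzan2024, Thm 1 (pp. 7–8)] [cite: VandenbergHaggstromKahn2005, Thm 1.5 (p. 6), Thm 2.1 (p. 9)] -/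
theorem setObserver_pair_exchange (w : Sym2 V → unitInterval) (O : Set V) (a c b : V) :
    (prodBernoulli w).real ((⋃ o ∈ O, openConn a o) ∩ ⋂ o ∈ O, (openConn c o)ᶜ : Set (BondConfig V)) *
        ((prodBernoulli w).real (openConn a b) - (prodBernoulli w).real (openConn c b)) ≤
      (prodBernoulli w).real ((openConn a c)ᶜ : Set (BondConfig V)) *
        ((prodBernoulli w).real (openConn a b ∩ ((⋃ o ∈ O, openConn a o) ∩ ⋂ o ∈ O, (openConn c o)ᶜ)) -
          (prodBernoulli w).real (openConn c b ∩ ((⋃ o ∈ O, openConn a o) ∩ ⋂ o ∈ O, (openConn c o)ᶜ))) := by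
  set μ := prodBernoulli w with hμ
  set D : Set (BondConfig V) := {ω | ∀ s ∈ ({a} : Set V), ∀ t ∈ ({c} : Set V), ¬ (openGraph ω).Reachable s t}
    with hD
  set A₂ : Set (BondConfig V) := (⋃ o ∈ O, openConn a o) ∩ ⋂ o ∈ O, (openConn c o)ᶜ with hA₂
  set Ab : Set (BondConfig V) := openConn a b with hAb
  set Cb : Set (BondConfig V) := openConn c b with hCb
  have hmeas : ∀ S : Set (BondConfig V), MeasurableSet S := fun _ => MeasurableSet.of_discrete
  have hDeq : D = (openConn a c : Set (BondConfig V))ᶜ := sep_singleton_singleton_eq a c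
  have ha : a ∈ ({a} : Set V) := rfl
  have hc : c ∈ ({c} : Set V) := rfl
  -- the type-(+) event `A₂ = {O ~ a} ∩ {O ≁ c}`
  have hA₂plus : ∀ ⦃ω ω' : BondConfig V⦄, (⋃ s ∈ ({a} : Set V), openEdgeCluster ω s) ⊆ (⋃ s ∈ ({a} : Set V), openEdgeCluster ω' s) →
      (⋃ t ∈ ({c} : Set V), openEdgeCluster ω' t) ⊆ (⋃ t ∈ ({c} : Set V), openEdgeCluster ω t) → ω ∈ A₂ → ω' ∈ A₂ := by
    intro ω ω' hs ht hω
    rcases hω with ⟨hω1, hω2⟩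
    refine ⟨?_, ?_⟩
    · obtain ⟨o, ho, hao⟩ := mem_iUnion₂.1 hω1
      exact mem_iUnion₂.2 ⟨o, ho, typePlus_openConn_of_mem {a} {c} ha o hs ht hao⟩
    · refine mem_iInter₂.2 fun o ho => ?_
      exact typePlus_not_openConn_of_mem {a} {c} hc o hs ht (mem_iInter₂.1 hω2 o ho)
  have hAbplus : ∀ ⦃ω ω' : BondConfig V⦄, (⋃ s ∈ ({a} : Set V), openEdgeCluster ω s) ⊆ (⋃ s ∈ ({a} : Set V), openEdgeCluster ω' s) →
      (⋃ t ∈ ({c} : Set V), openEdgeCluster ω' t) ⊆ (⋃ t ∈ ({c} : Set V), openEdgeCluster ω t) → ω ∈ Ab → ω' ∈ Ab :=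
    fun ω ω' hs ht hω => typePlus_openConn_of_mem {a} {c} ha b hs ht hω
  have hCbminus : ∀ ⦃ω ω' : BondConfig V⦄, (⋃ s ∈ ({a} : Set V), openEdgeCluster ω' s) ⊆ (⋃ s ∈ ({a} : Set V), openEdgeCluster ω s) →
      (⋃ t ∈ ({c} : Set V), openEdgeCluster ω t) ⊆ (⋃ t ∈ ({c} : Set V), openEdgeCluster ω' t) → ω ∈ Cb → ω' ∈ Cb :=
    fun ω ω' hs ht hω => typeMinus_openConn_of_mem {a} {c} hc b hs ht hω
  -- (1) `{a↔b}` and `A₂` are positively correlated given `D`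
  have step1 : μ.real (D ∩ Ab) * μ.real (D ∩ A₂) ≤ μ.real (D ∩ (Ab ∩ A₂)) * μ.real D :=
    typePlus_posAssoc w {a} {c} hAbplus hA₂plus
  -- (2) `A₂` and `{c↔b}` are negatively correlated given `D`
  have step2 : μ.real (D ∩ (A₂ ∩ Cb)) * μ.real (D ∩ (univ ∩ univ)) ≤
      μ.real (D ∩ (A₂ ∩ univ)) * μ.real (D ∩ (Cb ∩ univ)) :=
    setTwoClusterExchange w {a} {c} (A₁ := A₂) (A₂ := univ) (B₁ := Cb) (B₂ := univ)
      hA₂plus (fun _ _ _ _ _ => mem_univ _) hCbminus (fun _ _ _ _ _ => mem_univ _)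
  simp only [inter_univ] at step2
  -- `A₂ ⊆ D`: if `O ~ a` and `O ≁ c` then `a ↮ c`
  have hA₂D : A₂ ⊆ D := by
    intro ω hω
    rw [hDeq]
    rcases hω with ⟨h1, h2⟩
    obtain ⟨o, ho, hao⟩ := mem_iUnion₂.1 h1
    intro hac
    exact (mem_iInter₂.1 h2 o ho) ((show (openGraph ω).Reachable a c from hac).symm.trans hao)
  have e1 : D ∩ A₂ = A₂ := inter_eq_right.2 hA₂D
  have e2 : D ∩ (Ab ∩ A₂) = Ab ∩ A₂ := by
    rw [← inter_assoc, inter_comm D Ab, inter_assoc, e1]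
  have e3 : D ∩ (A₂ ∩ Cb) = Cb ∩ A₂ := by
    rw [← inter_assoc, e1, inter_comm]
  -- `μ(D ∩ a↔b) − μ(D ∩ c↔b) = μ(a↔b) − μ(c↔b)`: on `{a ↔ c}` the two events coincide
  have e4 : μ.real (D ∩ Ab) - μ.real (D ∩ Cb) = μ.real Ab - μ.real Cb := by
    have hsplitA := measureReal_inter_add_sdiff₀ (μ := μ) (s := Ab) (hmeas D).nullMeasurableSet
    have hsplitC := measureReal_inter_add_sdiff₀ (μ := μ) (s := Cb) (hmeas D).nullMeasurableSet
    have hsame : Ab \ D = Cb \ D := by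
      ext ω
      simp only [mem_sdiff, hDeq, mem_compl_iff, not_not]
      constructor
      · rintro ⟨hab, hac⟩
        exact ⟨(show (openGraph ω).Reachable a c from hac).symm.trans hab, hac⟩
      · rintro ⟨hcb, hac⟩
        exact ⟨(show (openGraph ω).Reachable a c from hac).trans hcb, hac⟩
    rw [inter_comm D Ab, inter_comm D Cb]
    rw [hsame] at hsplitA
    linarith
  rw [e1, e2] at step1
  rw [e3, e1] at step2
  rw [← hDeq]
  have hm := fun (S : Set (BondConfig V)) => (measureReal_nonneg : 0 ≤ μ.real S)
  nlinarith [step1, step2, e4, hm D, hm A₂, hm (Ab ∩ A₂), hm (Cb ∩ A₂)]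

/-- **KN Theorem 1 with a set observer** (witness designated in the uncontracted graph): if `μ(c↔b) ≤ μ(a↔b)` then for every vertex set `O`,
`μ(c↔b ∩ O~a ∩ O≁c) ≤ μ(a↔b ∩ O~a ∩ O≁c)`.  [cite: KozmaNitzan2024, Thm 1 (pp. 7–8)] [cite: VandenbergHaggstromKahn2005, Thm 1.5 (p. 6)] -/
theorem setObserver_pair (w : Sym2 V → unitInterval) (O : Set V) (a c b : V)
    (hca : (prodBernoulli w).real (openConn c b) ≤ (prodBernoulli w).real (openConn a b)) :
    (prodBernoulli w).real (openConn c b ∩ ((⋃ o ∈ O, openConn a o) ∩ ⋂ o ∈ O, (openConn c o)ᶜ)) ≤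
      (prodBernoulli w).real (openConn a b ∩ ((⋃ o ∈ O, openConn a o) ∩ ⋂ o ∈ O, (openConn c o)ᶜ)) := by
  set μ := prodBernoulli w with hμ
  have key := setObserver_pair_exchange w O a c b
  have hm := fun (S : Set (BondConfig V)) => (measureReal_nonneg : 0 ≤ μ.real S)
  have hlhs : 0 ≤ μ.real ((⋃ o ∈ O, openConn a o) ∩ ⋂ o ∈ O, (openConn c o)ᶜ : Set (BondConfig V)) *
      (μ.real (openConn a b) - μ.real (openConn c b)) := mul_nonneg (hm _) (by linarith)
  by_cases hD : μ.real ((openConn a c)ᶜ : Set (BondConfig V)) = 0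
  · -- `μ(a ↮ c) = 0`: the left event is null
    have hsub : (openConn c b ∩ ((⋃ o ∈ O, openConn a o) ∩ ⋂ o ∈ O, (openConn c o)ᶜ) : Set (BondConfig V)) ⊆
        (openConn a c)ᶜ := by
      rintro ω ⟨-, h1, h2⟩
      obtain ⟨o, ho, hao⟩ := mem_iUnion₂.1 h1
      intro hac
      exact (mem_iInter₂.1 h2 o ho) ((show (openGraph ω).Reachable a c from hac).symm.trans hao)
    have h0 : μ.real (openConn c b ∩ ((⋃ o ∈ O, openConn a o) ∩ ⋂ o ∈ O, (openConn c o)ᶜ)) = 0 :=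
      le_antisymm ((measureReal_mono hsub (measure_ne_top _ _)).trans hD.le) (hm _)
    rw [h0]
    exact hm _
  · have hDpos : 0 < μ.real ((openConn a c)ᶜ : Set (BondConfig V)) := lt_of_le_of_ne (hm _) (Ne.symm hD)
    nlinarith [key, hlhs, hDpos]

/-- **SET-W for one competitor relay** (the V⁺ set statement of MEMO-gen10 §3 for `A = {b, c, a}`): if `μ(c↔b) ≤ μ(a↔b)` then for every
vertex set `O`, `μ(c↔b ∩ O~a ∩ O≁c) ≤ μ(O~b ∩ O≁c)` ("conditionally on the block avoiding `c`, `c` reaching `b` while the block reaches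
`a` is less likely than the block reaching `b`").  For `O = {o}` this is KN's display (3) with `A = {b,c,a}`.
[cite: KozmaNitzan2024, Thm 1 (pp. 7–8), display (3) (p. 3)] -/
theorem setObserver_pair_setW (w : Sym2 V → unitInterval) (O : Set V) (a c b : V)
    (hca : (prodBernoulli w).real (openConn c b) ≤ (prodBernoulli w).real (openConn a b)) :
    (prodBernoulli w).real (openConn c b ∩ ((⋃ o ∈ O, openConn a o) ∩ ⋂ o ∈ O, (openConn c o)ᶜ)) ≤
      (prodBernoulli w).real ((⋃ o ∈ O, openConn b o) ∩ ⋂ o ∈ O, (openConn c o)ᶜ : Set (BondConfig V)) := by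
  refine (setObserver_pair w O a c b hca).trans (measureReal_mono ?_ (measure_ne_top _ _))
  rintro ω ⟨hab, h1, h2⟩
  obtain ⟨o, ho, hao⟩ := mem_iUnion₂.1 h1
  exact ⟨mem_iUnion₂.2 ⟨o, ho, ((show (openGraph ω).Reachable a b from hab).symm.trans hao :)⟩, h2⟩

end SetObserverPair

end

end Summit.CriticalPhenomena.PercolationContinuityZ3.Theorems
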